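import Summits.ABC.IUTFork.Thm311RealArchHermitianInd
import Summits.ABC.IUTFork.Thm311RealDH
import HarnessLib

/-!
# [IUTchIII] Theorem 3.11 over real definitions — print's archimedean integral structure is fixed by EVERY element
# of c312-1's (Ind1)/(Ind2) at `v_ℚ = ∞` whose archimedean binders are isometric; UNCONDITIONALLY for
# abc-iut-c312-5's Dupuy–Hilado signature `Real.logShellsDH`

Proof-only file (D-0012) of the abc-iut cell (WAVE-4 D-0067 cone-interior discharge prover, seat abc-iut-w4-d001,
gen 2; home layer L6); TAKES NO SIDE on [IUTchIII] Cor. 3.12. Sequel to `Thm311RealArchHermitianInd` (same seat: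
the generator facts `preimage_archPkHermitian_permute` / `preimage_archPkHermitian_factorwise_summandwise`).
abc-iut-c312-1's `Thm311Sig` types (Ind1) at label `j` as the SET `LogShells.Ind1 j` of families
`v_ℚ ↦ permute σ ≫ ⊗_i ⊕_v h_{i,v}` (`h_{i,v} ∈ stripAut v`) and (Ind2) at `(j, v_ℚ)` as the SET `LogShells.Ind2 j v_ℚ` of
`⊗_i ⊕_v g_{i,v}` (`g_{i,v} ∈ ism v`) ([IUTchIII] Thm. 3.11 (i), p. 154: at `v_ℚ ∈ 𝕍^arc_ℚ` (Ind2) is "copies of each of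
the automorphisms of order 2 whose orbit constitutes the poly-automorphism discussed in Proposition 1.2, (vii)").

PROVED here, for the real signature `Real.logShells X logv Aut Ism hAut hIsm`:
* `Real.preimage_archPkHermitian_of_mem_Ind2` / `…_of_mem_Ind1` — every element of `Ind2 j ∞`, resp. the `∞`-component of
  every element of `Ind1 j`, fixes `𝓘(^{S^±_{j+1}}𝒟⊢_∞) = Real.archPkHermitian j`, PROVIDED the archimedean binders
  `Ism (inl w)`, resp. `Aut (inl w)`, consist of automorphisms read in `ℂ` as real-linear isometries (the hypothesis
  shape `hIso` below — print's `{±1} × {id, conj}`, [AbsTopIII] Prop. 5.8 (v));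
* UNCONDITIONALLY for abc-iut-c312-5's `Real.logShellsDH X logv` (`Thm311RealDH`: `stripAutDH = {1}`,
  `ismDH (inl w) = {1, −1}`): `Real.isometric_stripAutDH_inl`, `Real.isometric_ismDH_inl`, hence
  **`Real.preimage_archPkHermitian_of_mem_Ind2_DH`** and **`Real.preimage_archPkHermitian_of_mem_Ind1_DH`** — at
  the cell's real Dupuy–Hilado-level setting, print's archimedean integral structure is (Ind1)- and (Ind2)-STABLE,
  no hypothesis.
With `Thm311RealArchShell` (typed (ii)-at-`∞` ⇔ trivial structure), `Thm311RealArchHermitian` (print's structure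
exists on the real packet and satisfies print's (Ind3) (b)(1)(2), not the typed all-places clause) and
abc-iut-w5-d043's `Thm311RealArchSpan` (comparison onto, image form), this is the archimedean dossier for an
instantiation of Thm. 3.11 (i)(a) at `v_ℚ = ∞` by `archPkHermitian` — the typers'/referees' call.
[claim: Mochizuki2012, status: disputed] for every quotation; classical. typed ≠ proved; instantiated ≠ endorsed.
-/

noncomputable section

namespace Summit.ABC.IUTFork.Thm311.Real

open NumberField Literature.IUT.LogVolume Literature.IUT.LogVolume.Prop15iii Literature.IUT.LogThetaLattice
open PiTensorProduct

variable {F : Type} [Field F] [NumberField F]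
variable (X : PilotData F) (logv : PadicLogs F) (Aut Ism : ∀ x : Place F, Set (Carrier x ≃ₗ[ℚ] Carrier x))
  (hAut : ∀ x, LinearEquiv.refl ℚ (Carrier x) ∈ Aut x) (hIsm : ∀ x, LinearEquiv.refl ℚ (Carrier x) ∈ Ism x)

variable [Fintype (ArchFibre X)]

/-! ## 1. General real signature: isometric archimedean binders -/

/-- **Every element of (Ind2) at `∞` fixes print's archimedean integral structure**, provided the archimedean
`Ism`-binder consists of automorphisms that are real-linear isometries when read in `ℂ`.
[claim: Mochizuki2012, status: disputed] -/
theorem preimage_archPkHermitian_of_mem_Ind2 (j : (thetaIndex X).Label)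
    (hIso : ∀ (w : ArchFibre X), ∀ g ∈ Ism w.1, ∃ σ : ℂ ≃ₗᵢ[ℝ] ℂ, ∀ a, archEmb X w (g a) = σ (archEmb X w a))
    {φ : (logShells X logv Aut Ism hAut hIsm).Packet j (infty X) ≃ₗ[ℚ]
      (logShells X logv Aut Ism hAut hIsm).Packet j (infty X)}
    (hφ : φ ∈ (logShells X logv Aut Ism hAut hIsm).Ind2 j (infty X)) :
    φ ⁻¹' archPkHermitian X logv Aut Ism hAut hIsm j = archPkHermitian X logv Aut Ism hAut hIsm j := by
  obtain ⟨g, hg, rfl⟩ := hφ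
  choose σ hσ using fun i w => hIso w (g i w) (hg i w)
  exact preimage_archPkHermitian_factorwise_summandwise X logv Aut Ism hAut hIsm j g σ
    (fun i w a => hσ i w a)

/-- **The `∞`-component of every element of (Ind1) fixes print's archimedean integral structure**, provided the
archimedean strip-automorphism binder `Aut` is isometric when read in `ℂ` (the permutation part is
unconditional, `preimage_archPkHermitian_permute`). [claim: Mochizuki2012, status: disputed] -/
theorem preimage_archPkHermitian_of_mem_Ind1 (j : (thetaIndex X).Label)
    (hIso : ∀ (w : ArchFibre X), ∀ g ∈ Aut w.1, ∃ σ : ℂ ≃ₗᵢ[ℝ] ℂ, ∀ a, archEmb X w (g a) = σ (archEmb X w a))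
    {Φ : ∀ vQ : (thetaIndex X).VQ, (logShells X logv Aut Ism hAut hIsm).Packet j vQ ≃ₗ[ℚ]
      (logShells X logv Aut Ism hAut hIsm).Packet j vQ}
    (hΦ : Φ ∈ (logShells X logv Aut Ism hAut hIsm).Ind1 j) :
    Φ (infty X) ⁻¹' archPkHermitian X logv Aut Ism hAut hIsm j = archPkHermitian X logv Aut Ism hAut hIsm j := by
  obtain ⟨σ, h, hh, hΦeq⟩ := hΦ
  choose τ hτ using fun i (w : ArchFibre X) => hIso w (h i w.1) (hh i w.1)
  have h1 := preimage_archPkHermitian_factorwise_summandwise X logv Aut Ism hAut hIsm j (fun i w => h i w.1) τ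
    (fun i w a => hτ i w a)
  have h2 := preimage_archPkHermitian_permute X logv Aut Ism hAut hIsm j σ
  ext t
  rw [hΦeq (infty X), Set.mem_preimage, LinearEquiv.trans_apply]
  exact (Set.ext_iff.mp h1 _).trans (Set.ext_iff.mp h2 t)

/-! ## 2. The Dupuy–Hilado signature: `stripAutDH = {1}`, `ismDH (inl w) = {±1}` are isometric -/

omit [Fintype (ArchFibre X)] in
/-- `archEmb` commutes with negation. [folklore] -/
theorem archEmb_neg (w : ArchFibre X) (a : Carrier w.1) : archEmb X w (-a) = -archEmb X w a := map_neg _ a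

omit [Fintype (ArchFibre X)] in
/-- The identity of `K_w` is read in `ℂ` as the identity isometry. [folklore] -/
theorem isometric_refl (w : ArchFibre X) :
    ∃ σ : ℂ ≃ₗᵢ[ℝ] ℂ, ∀ a, archEmb X w (LinearEquiv.refl ℚ (Carrier w.1) a) = σ (archEmb X w a) :=
  ⟨LinearIsometryEquiv.refl ℝ ℂ, fun _ => rfl⟩

omit [Fintype (ArchFibre X)] in
/-- `−1` on `K_w` is read in `ℂ` as the isometry `−1`. [folklore] -/
theorem isometric_neg (w : ArchFibre X) :
    ∃ σ : ℂ ≃ₗᵢ[ℝ] ℂ, ∀ a, archEmb X w (LinearEquiv.neg ℚ (M := Carrier w.1) a) = σ (archEmb X w a) :=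
  ⟨LinearIsometryEquiv.neg ℝ, fun a => by
    show archEmb X w (-a) = -archEmb X w a
    exact archEmb_neg X w a⟩

omit [Fintype (ArchFibre X)] in
/-- **c312-5's archimedean strip-automorphism binder is isometric** (`stripAutDH = {1}`).
[cite: DupuyHilado2025, §4.7] -/
theorem isometric_stripAutDH_inl (w : ArchFibre X) :
    ∀ g ∈ stripAutDH (F := F) w.1, ∃ σ : ℂ ≃ₗᵢ[ℝ] ℂ, ∀ a, archEmb X w (g a) = σ (archEmb X w a) := by
  intro g hg
  have hg' : g = LinearEquiv.refl ℚ _ := hg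
  subst hg'
  exact isometric_refl X w

omit [Fintype (ArchFibre X)] in
/-- **c312-5's archimedean `Ism`-binder is isometric** (`ismDH (inl w) = {1, −1}`: [IUTchIII] Thm. 3.11 (i) (Ind2) at
`v_ℚ ∈ 𝕍^arc_ℚ`, "copies of each of the automorphisms of order 2"). [claim: Mochizuki2012, status: disputed] -/
theorem isometric_ismDH_inl (w : ArchFibre X) :
    ∀ g ∈ ismDH logv w.1, ∃ σ : ℂ ≃ₗᵢ[ℝ] ℂ, ∀ a, archEmb X w (g a) = σ (archEmb X w a) := by
  obtain ⟨x, hx⟩ := w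
  rcases x with w' | v
  · intro g hg
    have hg' : g = LinearEquiv.refl ℚ _ ∨ g = LinearEquiv.neg ℚ := by
      simpa [ismDH, Set.mem_insert_iff, Set.mem_singleton_iff] using hg
    rcases hg' with rfl | rfl
    · exact isometric_refl X ⟨.inl w', hx⟩
    · exact isometric_neg X ⟨.inl w', hx⟩
  · exact absurd hx (by simp [thetaIndex])

/-- **At the Dupuy–Hilado real signature, every element of (Ind2) at `∞` fixes print's archimedean integral
structure — NO hypothesis.** [claim: Mochizuki2012, status: disputed] -/
theorem preimage_archPkHermitian_of_mem_Ind2_DH (j : (thetaIndex X).Label)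
    {φ : (logShellsDH X logv).Packet j (infty X) ≃ₗ[ℚ] (logShellsDH X logv).Packet j (infty X)}
    (hφ : φ ∈ (logShellsDH X logv).Ind2 j (infty X)) :
    φ ⁻¹' archPkHermitian X logv stripAutDH (ismDH logv) refl_mem_stripAutDH (refl_mem_ismDH logv) j =
      archPkHermitian X logv stripAutDH (ismDH logv) refl_mem_stripAutDH (refl_mem_ismDH logv) j :=
  preimage_archPkHermitian_of_mem_Ind2 X logv stripAutDH (ismDH logv) refl_mem_stripAutDH (refl_mem_ismDH logv) j
    (isometric_ismDH_inl X logv) hφ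

/-- **At the Dupuy–Hilado real signature, the `∞`-component of every element of (Ind1) fixes print's archimedean
integral structure — NO hypothesis.** [claim: Mochizuki2012, status: disputed] -/
theorem preimage_archPkHermitian_of_mem_Ind1_DH (j : (thetaIndex X).Label)
    {Φ : ∀ vQ : (thetaIndex X).VQ, (logShellsDH X logv).Packet j vQ ≃ₗ[ℚ] (logShellsDH X logv).Packet j vQ}
    (hΦ : Φ ∈ (logShellsDH X logv).Ind1 j) :
    Φ (infty X) ⁻¹' archPkHermitian X logv stripAutDH (ismDH logv) refl_mem_stripAutDH (refl_mem_ismDH logv) j =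
      archPkHermitian X logv stripAutDH (ismDH logv) refl_mem_stripAutDH (refl_mem_ismDH logv) j :=
  preimage_archPkHermitian_of_mem_Ind1 X logv stripAutDH (ismDH logv) refl_mem_stripAutDH (refl_mem_ismDH logv) j
    (isometric_stripAutDH_inl X) hΦ

end Summit.ABC.IUTFork.Thm311.Real

end
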